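import Literature.NumberTheory.Automorphic.LanglandsTunnellBridgeEigenModel
import Literature.NumberTheory.Automorphic.AutomorphicRepsGLAssociatedL2Holds
import Literature.NumberTheory.Automorphic.CuspidalRepDataOfL2Satake
import Literature.NumberTheory.Automorphic.LanglandsTetrahedralProofs
import Literature.NumberTheory.Automorphic.AutomorphicConjugate
import HarnessLib

/-!
# Tunnell's bridge from two named facts: the Satake transfer along Borel–Jacquet's association,
# proved (proofs; companion to `Literature.NumberTheory.Automorphic.LanglandsTunnellBridgeEigenModel`)

`LanglandsTunnellBridgeEigenModel` proves the named fact
`Literature.NumberTheory.Automorphic.hasEntireContinuation_artinLFunction_of_isPiOfArtinRep`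
(Tunnell, Bull. AMS 5 (1981), p. 173, ¶2: "When `π = π(ρ)` the L-series of `π` and `ρ` agree, and
since cuspidal representations have entire L-series, Artin's conjecture follows") from four named
facts of the tree (`hasEntireContinuation_artinLFunction_of_isPiOfArtinRep_of_four_facts`): Artin's
functional equation (FE) `artin_functional_equation`, Godement–Jacquet for `GL₂` (GJ)
`godementJacquet (n := 2)`, and Borel–Jacquet's dictionary between cuspidal data `π = W / W'` and
cuspidal `Π ≤ L²_cusp` — (A) `AutomorphicRepsGL.exists_isAssociatedL2` and (L2)
`hasSatakeParamAt_iff_L2`. Of the dictionary the bridge consumes exactly this: an `A_G`-invariant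
cuspidal datum `π₀` is associated (`IsAssociatedL2 π₀ Π`: `W = W' ⊔ V_Π`) with some cuspidal `Π`,
and, at almost every finite place `v`, every Satake parameter of `Π` at `v` in the `L²` sense is a
Satake parameter of `π₀` at `v` in Borel–Jacquet's sense. (A) is now a theorem of the tree
(`AutomorphicRepsGL.exists_isAssociatedL2_holds`, `AutomorphicRepsGLAssociatedL2Holds`), and this
file PROVES the almost-everywhere transfer along *any* association, so that the bridge rests on
the two analytic facts (FE) and (GJ) alone:

* `hasSatakeParamAt_of_isAssociatedL2_eventually` (**main lemma**, `GL_n`, every `n`): if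
  `IsAssociatedL2 π Π` then for almost every `v`, whenever `HasSatakeParameterAt Π K(𝔫) v ϖ β`
  (`𝔫 ≠ 0`, `v ∤ 𝔫`, any uniformizer `ϖ`), `π.HasSatakeParamAt v β`. Proof (Borel–Jacquet 1979,
  4.6, the part "`invQuot` intertwines `L²` with right translation of forms"; the argument of
  `CuspidalRepDataOfL2Satake`, run inside the given datum instead of a generated one): since
  `W' < W = W' ⊔ V_Π`, some `φ₀ ∈ V_Π` lies outside `W'`; `φ₀ = invQuot f₀` with `[f₀] ∈ Π`
  (`exists_toLp_mem_of_mem_formsOfL2_gl`) is a cusp form, right invariant under some `K(𝔫₀)`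
  (Borel–Jacquet 4.2 (a); `exists_principalCongruenceLevel_rightTranslation_eq` of
  `CuspidalRepDataOfL2Satake`), so `[f₀] ∈ Π^{K(𝔫₀)}`
  (`toLp_mem_fixedVectors_of_rightTranslation_invQuot_eq`); with `α` a Satake family of `Π` off a
  finite `S` (`exists_isSatakeFamilyOf_holds`, Flath 1979, Thm. 3), at every `v ∉ S`, `v ∤ 𝔫₀`, the
  operators `T_{v,i}` act on `[f₀]` by `q_v^{i(n-i)/2} e_i(α v)` (`heckeOperatorAt_eq_satake_smul`),
  hence pointwise on `φ₀` (`heckeOperator_invQuot_eq_smul_of_heckeOperatorAt_eq_smul`): `φ₀ ∈ W ∖ W'`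
  is an exact `K(𝔫₀)`-invariant Hecke eigenform, so `π.HasSatakeParamAt v (α v)`; and any `L²`
  Satake parameter `β` of `Π` at `v` equals `α v` (`HasSatakeParameterAt.eq_of_ofLocal_eq_smul`,
  `Flath1979_heckeOperatorAt_ofLocal_eq_smul_holds`). No irreducibility or admissibility of `V_Π`
  is used.
* `hasSatakeParamAt_iff_L2_eventually` (`GL_n`): along any association the two notions of Satake
  parameter agree at almost every place — the statement of `hasSatakeParamAt_iff_L2` for the pair
  `(π, Π)` off a finite set ("`⇒`" by the uniqueness of Borel–Jacquet Satake parameters,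
  `AutomorphicRepData.hasSatakeParamAt_unique_holds`).
* `CuspidalAutomorphicRepData.exists_isAssociatedL2_hasSatakeParamAt_eventually` (`GL_n`): an
  `A_G`-invariant cuspidal datum is associated with a cuspidal `Π ≤ L²_cusp` all of whose `L²`
  Satake parameters, at almost every place, are Satake parameters of the datum
  (`AutomorphicRepsGL.exists_isAssociatedL2_holds` and the main lemma).
* `hasEntireContinuation_artinLFunction_of_isPiOfArtinRep_of_FE_of_entire_partialL` — **Tunnell's
  bridge from (FE) and the exact analytic input (L)**: for every cuspidal `Π ≤ L²_cusp(GL₂)` some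
  Satake family `α₀` off a finite `S₀` with `L^{S₀}(s, α₀)`, `L^{S₀}(s, α₀⁻¹)` continuing to entire
  functions (Jacquet–Langlands 1970, Thm. 11.1). Proof: the transfer hypothesis (T) of
  `hasEntireContinuation_artinLFunction_of_isPiOfArtinRep_of_exists` / `exists_entire_partialL_of_transfer`
  (`LanglandsTunnellBridgeL2`) is discharged by the `A_G`-normalisation
  (`CuspidalAutomorphicRepData.exists_centerInvariant_hasSatakeParamAt_shift_eventually`,
  `LanglandsTunnellBridgeEigenModel`), the automorphic measure
  (`AdelicGroupData.exists_isAutomorphicMeasure_gl_holds`) and the previous theorem.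
* `hasEntireContinuation_artinLFunction_of_isPiOfArtinRep_of_two_facts` — **Tunnell's bridge from
  the two named facts (FE) and (GJ) alone** ((L) from (GJ): `exists_entire_partialL_of_godementJacquet`).
* `exists_entire_partialL_and_dual_of_entire_partialL` (`GL_n`) and
  `hasEntireContinuation_artinLFunction_of_isPiOfArtinRep_of_FE_of_entire_partialL_oneSided` —
  **(L) from the one-sided statement (L¹)** "the partial standard L-function `L^S(s, γ)` of every
  cuspidal `Π ≤ L²_cusp(GL₂)`, for every Satake family `γ` off a finite `S`, continues to an entire
  function from some right half-plane": the dual family `α⁻¹` of a Satake family of `Π` is the conjugate family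
  (`IsSatakeFamilyOf.map_inv_eq_map_conj`: unramified components of `L²`-automorphic
  representations are unitary), which is a Satake family of the conjugate representation `Π̄`
  (`CuspidalAutomorphicRepGL.conj`, `IsSatakeFamilyOf.conj`), so (L¹) for `Π` and `Π̄` is (L).
  Hence the bridge also rests on (FE) and (L¹) alone.
* `langlands_tunnell_hasEntireContinuation_of_cases_of_two_facts` — the target over `ℚ` from the
  three cases of strong Artin, (FE) and (GJ).

Consequently the discharge `hasEntireContinuation_artinLFunction_of_isPiOfArtinRep_holds` is the term
`hasEntireContinuation_artinLFunction_of_isPiOfArtinRep_of_two_facts` applied to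
`artin_functional_equation_holds` and `godementJacquet_holds (n := 2)`, once they exist. Everything
here is proved; no definition, no named fact, nothing restated.

## References

* J. Tunnell, *Artin's conjecture for representations of octahedral type*, Bull. AMS 5 (1981),
  p. 173 [Tunnell1981].
* J. Arthur, L. Clozel, *Simple algebras, base change, and the advanced theory of the trace
  formula*, Ann. of Math. Stud. 120 (1989), Ch. 3, §2 (p. 172) [ArthurClozelAMS120].
* A. Borel, H. Jacquet, *Automorphic forms and automorphic representations*, Proc. Sympos. Pure
  Math. 33 (1979), part 1, §4.6, 5.7 [BorelJacquetCorvallis1979].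
* D. Flath, *Decomposition of representations into tensor products*, Proc. Sympos. Pure Math. 33,
  part 1 (1979), Thm. 3 [FlathCorvallis1979].
* R. Godement, H. Jacquet, *Zeta functions of simple algebras*, LNM 260 (1972), Thm. 13.8
  [GodementJacquet1972].
* H. Jacquet, R. P. Langlands, *Automorphic forms on GL(2)*, LNM 114 (1970), §11, Thm. 11.1
  [JacquetLanglands1970].
* J. Neukirch, *Algebraic Number Theory* (1999), VII §12, Thm. (12.6) [NeukirchANT1999].
-/

noncomputable section

open scoped MatrixGroups Classical
open NumberField IsDedekindDomain MeasureTheory Filter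

namespace Literature.NumberTheory.Automorphic

open AdelicGroupData

/-! ### The Satake transfer `L² → Borel–Jacquet` along an association, almost everywhere -/

section Transfer

variable {n : ℕ} {K : Type} [Field K] [NumberField K] {hcpt : isCompact_glFiniteIntegralLevel n K}
  {μ : Measure (gl n K).automorphicQuotient} [(gl n K).IsAutomorphicMeasure μ]

/-- **Satake parameters transfer from `Π ≤ L²_cusp` to an associated Borel–Jacquet datum, at almost
every place.** Let `π = W / W'` be a cuspidal automorphic representation datum of `GL_n(𝔸_K)`
associated with the cuspidal `Π ≤ L²_cusp(GL_n(𝔸_K) ⧸ A_G GL_n(K), μ)` (`IsAssociatedL2 π Π`: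
`W = W' ⊔ V_Π`). Then for almost every finite place `v`: whenever `β` is a Satake parameter of `Π`
at `v` in the `L²` sense (`HasSatakeParameterAt Π K(𝔫) v ϖ β`, `𝔫 ≠ 0`, `v ∤ 𝔫`, any uniformizer
`ϖ`), `β` is a Satake parameter of `π` at `v` (`HasSatakeParamAt`: Hecke eigenvalues modulo `W'` of a
`K(𝔫₀)`-invariant form in `W ∖ W'`). The witness is one and the same form for all these `v`: some
`φ₀ = invQuot f₀ ∈ V_Π ∖ W'`, `[f₀] ∈ Π^{K(𝔫₀)}`, on which the unramified Hecke operators act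
pointwise by the Satake scalars of `Π` (Flath). This is the direction "`⇐`", almost everywhere, of
the named fact `hasSatakeParamAt_iff_L2` (Borel–Jacquet 1979, 4.6), which is all that Tunnell's
bridge consumes of it. [cite: BorelJacquetCorvallis1979, §4.6] [cite: FlathCorvallis1979, Thm. 3] -/
theorem hasSatakeParamAt_of_isAssociatedL2_eventually (π : CuspidalAutomorphicRepData n K hcpt)
    (P : CuspidalAutomorphicRepGL n K μ) (h : IsAssociatedL2 π P) :
    ∀ᶠ v : HeightOneSpectrum (𝓞 K) in cofinite,
      ∀ (𝔫 : Ideal (𝓞 K)) (ϖ : (v.adicCompletion K)ˣ) (β : Multiset ℂ), 𝔫 ≠ 0 →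
        ¬ v.asIdeal ∣ 𝔫 → HasSatakeParameterAt P.1 (principalCongruenceLevel n K 𝔫) v ϖ β →
          π.1.HasSatakeParamAt v β := by
  -- a Satake family `α` of `Π` off a finite `S`
  obtain ⟨S, α, -, hα⟩ := exists_isSatakeFamilyOf_holds (n := n) (K := K) (μ := μ) P
  -- Step 1: a form `φ₀ ∈ V_Π` outside `W'` (`W' < W = W' ⊔ V_Π`)
  have hV : ¬ formsOfL2 hcpt μ P.1 ≤ π.1.W' := by
    intro hle
    have hW : π.1.W ≤ π.1.W' := by
      rw [h]
      exact sup_le le_rfl hle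
    exact absurd (le_antisymm hW π.1.lt.le) π.1.lt.ne'
  obtain ⟨φ₀, hφ₀V, hφ₀W'⟩ := SetLike.not_le_iff_exists.1 hV
  have hφ₀W : φ₀ ∈ π.1.W := by
    rw [h]
    exact Submodule.mem_sup_right hφ₀V
  -- Step 2: `φ₀ = invQuot f₀`, `[f₀] ∈ Π`, continuous
  obtain ⟨f₀, hf₀, hf₀P, hφf, hφ₀c⟩ := exists_toLp_mem_of_mem_formsOfL2_gl hφ₀V
  subst hφf
  have hf₀P' : hf₀.toLp f₀ ∈ P.1.toSubmodule := hf₀P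
  have hf₀c : Continuous f₀ := continuous_of_continuous_invQuot hφ₀c
  -- Step 3: a level `K(𝔫₀)` of the cusp form `φ₀`; `[f₀] ∈ Π^{K(𝔫₀)}`
  obtain ⟨𝔫₀, h𝔫₀, hfix⟩ := exists_principalCongruenceLevel_rightTranslation_eq
    (cuspFormsGL_le_automorphicForms n K hcpt (π.le_cuspFormsGL hφ₀W))
  have hFfix : (⟨hf₀.toLp f₀, hf₀P'⟩ : P.1.toSubmodule) ∈
      P.1.fixedVectors (principalCongruenceLevel n K 𝔫₀) :=
    toLp_mem_fixedVectors_of_rightTranslation_invQuot_eq hf₀ hf₀P' hfix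
  -- Step 4: at almost every `v` (`v ∉ S`, `v ∤ 𝔫₀`) `φ₀` is an exact Hecke eigenform with the
  -- Satake eigenvalues of `Π`, and every `L²` Satake parameter of `Π` at `v` is `α v`
  have c1 : ∀ᶠ v : HeightOneSpectrum (𝓞 K) in cofinite, v ∉ (S : Set (HeightOneSpectrum (𝓞 K))) :=
    S.finite_toSet.compl_mem_cofinite
  have c2 : ∀ᶠ v : HeightOneSpectrum (𝓞 K) in cofinite, ¬ v.asIdeal ∣ 𝔫₀ :=
    (Ideal.finite_factors h𝔫₀).compl_mem_cofinite
  filter_upwards [c1, c2] with v hvS hv𝔫₀ 𝔫 ϖ β h𝔫 hv𝔫 hβ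
  -- `β = α v` (Satake parameters of `Π` do not depend on level, uniformizer, eigenvector)
  obtain ⟨𝔫', h𝔫', hv𝔫', ϖ', hϖ'⟩ := hα v hvS
  have hαβ : α v = β := HasSatakeParameterAt.eq_of_ofLocal_eq_smul
    Flath1979_heckeOperatorAt_ofLocal_eq_smul_holds P h𝔫' h𝔫 hv𝔫' hv𝔫 hϖ' hβ
  subst hαβ
  -- the `L²` eigen-equations at level `K(𝔫₀)`, made pointwise
  obtain ⟨ϖ₀, hϖ₀, hT⟩ := heckeOperatorAt_eq_satake_smul P hα h𝔫₀ hvS hv𝔫₀ hFfix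
  refine ⟨𝔫₀, ϖ₀, h𝔫₀, hv𝔫₀, hϖ₀, hα.card_eq hvS, invQuot (gl n K) f₀, hφ₀W, hφ₀W', hfix,
    fun i hi => ?_⟩
  rw [heckeOperator_invQuot_eq_smul_of_heckeOperatorAt_eq_smul
    (finite_orbit_heckeDiagAt h𝔫₀ hv𝔫₀ hϖ₀ i) hf₀ hf₀P' hf₀c hfix (hT i hi), sub_self]
  exact Submodule.zero_mem _

/-- **The two notions of Satake parameter agree along an association, at almost every place**:
if `IsAssociatedL2 π Π` then for almost every finite place `v` and every multiset `β`,
`π.HasSatakeParamAt v β` (Borel–Jacquet side: Hecke eigenvalues modulo `W'` of a level-`K(𝔫)` form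
in `W ∖ W'`) iff `HasSatakeParameterAt Π K(𝔫) v ϖ β` for some `𝔫 ≠ 0` prime to `v` and some `ϖ`
(`L²` side) — the statement of the named fact `hasSatakeParamAt_iff_L2` (Borel–Jacquet 1979, 4.6) for
the pair `(π, Π)`, off a finite set of places. "`⇐`" is `hasSatakeParamAt_of_isAssociatedL2_eventually`;
"`⇒`": off the ramified places of `Π`, `Π` has an `L²` Satake parameter `α v`, which is then a Satake
parameter of `π`, and Satake parameters of `π` are unique
(`AutomorphicRepData.hasSatakeParamAt_unique_holds`, Flath 1979, Thm. 3).
[cite: BorelJacquetCorvallis1979, §4.6] [cite: FlathCorvallis1979, Thm. 3] -/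
theorem hasSatakeParamAt_iff_L2_eventually (π : CuspidalAutomorphicRepData n K hcpt)
    (P : CuspidalAutomorphicRepGL n K μ) (h : IsAssociatedL2 π P) :
    ∀ᶠ v : HeightOneSpectrum (𝓞 K) in cofinite, ∀ β : Multiset ℂ,
      π.1.HasSatakeParamAt v β ↔
        ∃ (𝔫 : Ideal (𝓞 K)) (ϖ : (v.adicCompletion K)ˣ), 𝔫 ≠ 0 ∧ ¬ v.asIdeal ∣ 𝔫 ∧
          HasSatakeParameterAt P.1 (principalCongruenceLevel n K 𝔫) v ϖ β := by
  obtain ⟨S, α, -, hα⟩ := exists_isSatakeFamilyOf_holds (n := n) (K := K) (μ := μ) P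
  have c1 : ∀ᶠ v : HeightOneSpectrum (𝓞 K) in cofinite, v ∉ (S : Set (HeightOneSpectrum (𝓞 K))) :=
    S.finite_toSet.compl_mem_cofinite
  filter_upwards [hasSatakeParamAt_of_isAssociatedL2_eventually π P h, c1] with v hv hvS β
  obtain ⟨𝔫, h𝔫, hv𝔫, ϖ, hϖ⟩ := hα v hvS
  refine ⟨fun hβ => ?_, fun ⟨𝔫', ϖ', h𝔫', hv𝔫', hβ⟩ => hv 𝔫' ϖ' β h𝔫' hv𝔫' hβ⟩
  have hαv : π.1.HasSatakeParamAt v (α v) := hv 𝔫 ϖ (α v) h𝔫 hv𝔫 hϖ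
  obtain rfl : α v = β := π.1.hasSatakeParamAt_unique_holds hαv hβ
  exact ⟨𝔫, ϖ, h𝔫, hv𝔫, hϖ⟩

variable (μ) in
/-- **An `A_G`-invariant cuspidal datum is realised in `L²_cusp` with the same Satake parameters
almost everywhere.** Every cuspidal automorphic representation datum `π = W / W'` of `GL_n(𝔸_K)`
whose forms are invariant under the split centre `A_G` is associated with a cuspidal
`Π ≤ L²_cusp(GL_n(𝔸_K) ⧸ A_G GL_n(K), μ)` (`AutomorphicRepsGL.exists_isAssociatedL2_holds`:
Borel–Jacquet 1979, 4.4–4.6, a theorem of the tree) such that, at almost every finite place, every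
`L²` Satake parameter of `Π` is a Satake parameter of `π`
(`hasSatakeParamAt_of_isAssociatedL2_eventually`). [cite: BorelJacquetCorvallis1979, §4.6] -/
theorem CuspidalAutomorphicRepData.exists_isAssociatedL2_hasSatakeParamAt_eventually
    (π : CuspidalAutomorphicRepData n K hcpt)
    (hπ : ∀ φ ∈ π.1.W, ∀ z ∈ (gl n K).center', ∀ g, φ (z * g) = φ g) :
    ∃ P : CuspidalAutomorphicRepGL n K μ, IsAssociatedL2 π P ∧
      ∀ᶠ v : HeightOneSpectrum (𝓞 K) in cofinite,
        ∀ (𝔫 : Ideal (𝓞 K)) (ϖ : (v.adicCompletion K)ˣ) (β : Multiset ℂ), 𝔫 ≠ 0 →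
          ¬ v.asIdeal ∣ 𝔫 → HasSatakeParameterAt P.1 (principalCongruenceLevel n K 𝔫) v ϖ β →
            π.1.HasSatakeParamAt v β := by
  obtain ⟨P, hP⟩ := AutomorphicRepsGL.exists_isAssociatedL2_holds hcpt μ π hπ
  exact ⟨P, hP, hasSatakeParamAt_of_isAssociatedL2_eventually π P hP⟩

end Transfer

/-! ### The bridge from (FE) and the entire continuation of `L^S(s, Π)`, `L^S(s, Π̃)` on `GL₂` -/

section Main

/-- **Tunnell's bridge from Artin's functional equation and the entire continuation of the partial
standard L-functions of cuspidal `Π ≤ L²_cusp(GL₂)` and their duals** — the exact analytic input.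
Assume, over every number field `F`: (FE) `artin_functional_equation` (Neukirch VII (12.6)); and (L),
for every automorphic measure `μ` and every cuspidal `Π ≤ L²_cusp(GL₂(𝔸_F) ⧸ A_G GL₂(F), μ)`, a
finite `S₀` and a Satake family `α₀` of `Π` off `S₀` such that `L^{S₀}(s, α₀)` and `L^{S₀}(s, α₀⁻¹)`
continue to entire functions from a right half-plane (Jacquet–Langlands 1970, Thm. 11.1: "`L(s, π)`
and `L(s, π̃)` are entire"; Godement–Jacquet 1972, Thm. 13.8). Then
`hasEntireContinuation_artinLFunction_of_isPiOfArtinRep` holds: for `σ : Γ_F → GL_2(ℂ)` irreducible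
and `π` cuspidal with `π = π(σ)` almost everywhere, `L(s, σ)` is entire (Tunnell 1981, p. 173 ¶2).
Proof: normalise `π` to an `A_G`-invariant `π₀` with the same Satake parameters up to `q_v^{-w}`
(`CuspidalAutomorphicRepData.exists_centerInvariant_hasSatakeParamAt_shift_eventually`; Borel–Jacquet
1979, 5.7), choose an automorphic measure (`AdelicGroupData.exists_isAutomorphicMeasure_gl_holds`),
realise `π₀` in `L²_cusp` with the same Satake parameters almost everywhere
(`CuspidalAutomorphicRepData.exists_isAssociatedL2_hasSatakeParamAt_eventually`; Borel–Jacquet 1979,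
4.6), shift the partial L-functions back (`exists_entire_partialL_of_transfer`) and conclude by
`hasEntireContinuation_artinLFunction_of_isPiOfArtinRep_of_exists` (`LanglandsTunnellBridgeL2`:
continuation of `L(s, σ)`, `L(s, σ^∨)` to `re s > 0`, then (FE)). [cite: Tunnell1981, p. 173]
[cite: JacquetLanglands1970, §11, Thm. 11.1] [cite: BorelJacquetCorvallis1979, §4.6 and 5.7]
[cite: NeukirchANT1999, VII §12, Thm. (12.6)] -/
theorem hasEntireContinuation_artinLFunction_of_isPiOfArtinRep_of_FE_of_entire_partialL
    (hFE : ∀ (F : Type) [Field F] [NumberField F], artin_functional_equation (K := F))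
    (hL : ∀ (F : Type) [Field F] [NumberField F]
      (μ : Measure (AdelicGroupData.gl 2 F).automorphicQuotient)
      [(AdelicGroupData.gl 2 F).IsAutomorphicMeasure μ] (P : CuspidalAutomorphicRepGL 2 F μ),
      ∃ (S₀ : Finset (HeightOneSpectrum (𝓞 F))) (α₀ : SatakeFamily F),
        IsSatakeFamilyOf P ↑S₀ α₀ ∧
        (∃ g : ℂ → ℂ, Differentiable ℂ g ∧ ∃ x₀ : ℝ, ∀ s : ℂ, x₀ < s.re →
          g s = partialStandardL ↑S₀ α₀ s) ∧
        (∃ g : ℂ → ℂ, Differentiable ℂ g ∧ ∃ x₀ : ℝ, ∀ s : ℂ, x₀ < s.re →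
          g s = partialStandardL ↑S₀ (dualFamily α₀) s)) :
    hasEntireContinuation_artinLFunction_of_isPiOfArtinRep := by
  intro F _ _ σ hcpt π _ hπ
  -- (N): an `A_G`-invariant `π₀` with the Satake parameters of `π` up to the shift `q_v^{-w}`
  obtain ⟨π₀, w, h₀, hN⟩ := π.exists_centerInvariant_hasSatakeParamAt_shift_eventually
  -- an automorphic measure and a cuspidal `Π ≤ L²_cusp` realising `π₀`, Satake parameters included
  obtain ⟨μ, hμ⟩ := AdelicGroupData.exists_isAutomorphicMeasure_gl_holds 2 F
  obtain ⟨P, -, hP⟩ := π₀.exists_isAssociatedL2_hasSatakeParamAt_eventually μ h₀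
  -- the transfer hypothesis (T) of `LanglandsTunnellBridgeL2`
  have hT : ∀ᶠ v in cofinite, ∀ β : Multiset ℂ,
      (∃ 𝔫 : Ideal (𝓞 F), 𝔫 ≠ 0 ∧ ¬ v.asIdeal ∣ 𝔫 ∧ ∃ ϖ : (v.adicCompletion F)ˣ,
        HasSatakeParameterAt P.1 (principalCongruenceLevel 2 F 𝔫) v ϖ β) →
      π.1.HasSatakeParamAt v (β.map (· * (v.residueCard : ℂ) ^ (-w))) := by
    filter_upwards [hN, hP] with v hv hv' β hβ
    obtain ⟨𝔫, h𝔫, hv𝔫, ϖ, hϖ⟩ := hβ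
    exact hv β (hv' 𝔫 ϖ β h𝔫 hv𝔫 hϖ)
  exact hasEntireContinuation_artinLFunction_of_isPiOfArtinRep_of_exists (hFE F) σ π hπ
    (exists_entire_partialL_of_transfer π P w hT (hL F μ P))

/-- **Tunnell's bridge from Artin's functional equation and Godement–Jacquet for `GL₂` alone** (the
two named facts of the tree that remain behind it). Assume, over every number field: (FE)
`artin_functional_equation`; and, for every automorphic measure, (GJ) `godementJacquet (n := 2)`
(the standard L-function of a cuspidal `Π ≤ L²_cusp(GL₂)` is entire, with functional equation
against a cuspidal `Π'` carrying the inverse Satake parameters; Godement–Jacquet 1972, Thm. 13.8;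
for `n = 2` Jacquet–Langlands 1970, Thm. 11.1). Then
`hasEntireContinuation_artinLFunction_of_isPiOfArtinRep` holds: the previous theorem with (L)
extracted from (GJ) (`exists_entire_partialL_of_godementJacquet`, `LanglandsTunnellBridgeL2`).
[cite: Tunnell1981, p. 173] [cite: GodementJacquet1972, Thm. 13.8]
[cite: BorelJacquetCorvallis1979, §4.6 and 5.7] [cite: NeukirchANT1999, VII §12, Thm. (12.6)] -/
theorem hasEntireContinuation_artinLFunction_of_isPiOfArtinRep_of_two_facts
    (hFE : ∀ (F : Type) [Field F] [NumberField F], artin_functional_equation (K := F))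
    (hGJ : ∀ (F : Type) [Field F] [NumberField F]
      (μ : Measure (AdelicGroupData.gl 2 F).automorphicQuotient)
      [(AdelicGroupData.gl 2 F).IsAutomorphicMeasure μ], godementJacquet (n := 2) (K := F) (μ := μ)) :
    hasEntireContinuation_artinLFunction_of_isPiOfArtinRep :=
  hasEntireContinuation_artinLFunction_of_isPiOfArtinRep_of_FE_of_entire_partialL hFE
    fun F _ _ μ _ P => exists_entire_partialL_of_godementJacquet (hGJ F μ) P

/-- **The target over `ℚ` from the three cases of strong Artin, (FE) and (GJ)**
(`langlands_tunnell_hasEntireContinuation_of_cases` with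
`hasEntireContinuation_artinLFunction_of_isPiOfArtinRep_of_two_facts`).
[cite: Tunnell1981, p. 173 and Theorem] [cite: LanglandsBaseChange1980, §3] -/
theorem langlands_tunnell_hasEntireContinuation_of_cases_of_two_facts
    (hd : strongArtin_of_isDihedralType) (ht : strongArtin_of_isTetrahedralType)
    (ho : strongArtin_of_isOctahedralType)
    (hFE : ∀ (F : Type) [Field F] [NumberField F], artin_functional_equation (K := F))
    (hGJ : ∀ (F : Type) [Field F] [NumberField F]
      (μ : Measure (AdelicGroupData.gl 2 F).automorphicQuotient)
      [(AdelicGroupData.gl 2 F).IsAutomorphicMeasure μ], godementJacquet (n := 2) (K := F) (μ := μ)) :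
    langlands_tunnell_hasEntireContinuation :=
  langlands_tunnell_hasEntireContinuation_of_cases hd ht ho
    (hasEntireContinuation_artinLFunction_of_isPiOfArtinRep_of_two_facts hFE hGJ)

end Main

/-! ### The one-sided analytic input: `L^S(s, Π)` entire for every cuspidal `Π` on `GL₂` -/

section OneSided

variable {n : ℕ} {K : Type} [Field K] [NumberField K]
  {μ : Measure (gl n K).automorphicQuotient} [(gl n K).IsAutomorphicMeasure μ]

/-- **(L) from the one-sided statement (L¹).** If the partial standard L-function `L^S(s, γ)` of
every cuspidal `Π ≤ L²_cusp(GL_n(𝔸_K) ⧸ A_G GL_n(K), μ)`, for every Satake family `γ` of `Π` off a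
finite `S`, continues to an entire function from some right half-plane, then every cuspidal `Π` has
a finite `S₀` and a Satake family `α₀` off `S₀` with both `L^{S₀}(s, α₀)` and `L^{S₀}(s, α₀⁻¹)`
continuing to entire functions from a right half-plane: take any Satake family of `Π` off its
ramified places (`exists_isSatakeFamilyOf_holds`, Flath 1979, Thm. 3); its inverse family is its
conjugate family place by place (`IsSatakeFamilyOf.map_inv_eq_map_conj`: the unramified components
of `Π ⊂ L²` are unitary, `\bar t_{Π,v} = t_{Π,v}⁻¹`; Arthur–Clozel 1989, Ch. 3, p. 172), and the
conjugate family is a Satake family of the complex-conjugate representation `Π̄ ≤ L²_cusp`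
(`CuspidalAutomorphicRepGL.conj`, `IsSatakeFamilyOf.conj`), to which (L¹) applies. (For `n = 2`:
Jacquet–Langlands 1970, Thm. 11.1, "`L(s, π)` and `L(s, π̃)` are entire", with `π̃ ≅ π̄` for unitary
`π`.) A hypothesis of the shape `LFunction.HasEntireContinuation (partialStandardL ↑S γ)` (agreement
on `re s > 1`) is the case `x₀ = 1` of (L¹).
[cite: JacquetLanglands1970, §11, Thm. 11.1] [cite: ArthurClozelAMS120, Ch. 3, §2 (p. 172)]
[cite: FlathCorvallis1979, Thm. 3] -/
theorem exists_entire_partialL_and_dual_of_entire_partialL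
    (hL : ∀ (P : CuspidalAutomorphicRepGL n K μ) (S : Finset (HeightOneSpectrum (𝓞 K)))
      (γ : SatakeFamily K), IsSatakeFamilyOf P ↑S γ →
        ∃ g : ℂ → ℂ, Differentiable ℂ g ∧ ∃ x₀ : ℝ, ∀ s : ℂ, x₀ < s.re →
          g s = partialStandardL ↑S γ s)
    (P : CuspidalAutomorphicRepGL n K μ) :
    ∃ (S₀ : Finset (HeightOneSpectrum (𝓞 K))) (α₀ : SatakeFamily K),
      IsSatakeFamilyOf P ↑S₀ α₀ ∧
      (∃ g : ℂ → ℂ, Differentiable ℂ g ∧ ∃ x₀ : ℝ, ∀ s : ℂ, x₀ < s.re →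
        g s = partialStandardL ↑S₀ α₀ s) ∧
      (∃ g : ℂ → ℂ, Differentiable ℂ g ∧ ∃ x₀ : ℝ, ∀ s : ℂ, x₀ < s.re →
        g s = partialStandardL ↑S₀ (dualFamily α₀) s) := by
  obtain ⟨S₀, α₀, -, hα₀⟩ := exists_isSatakeFamilyOf_holds (n := n) (K := K) (μ := μ) P
  -- the dual family is the conjugate family, a Satake family of `Π̄`
  have hdual : IsSatakeFamilyOf P.conj ↑S₀ (dualFamily α₀) := by
    intro v hv
    have h := hα₀.conj v hv
    have heq : dualFamily α₀ v = (α₀ v).map (starRingEnd ℂ) := hα₀.map_inv_eq_map_conj hv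
    rw [heq]
    exact h
  exact ⟨S₀, α₀, hα₀, hL P S₀ α₀ hα₀, hL P.conj S₀ (dualFamily α₀) hdual⟩

/-- **Tunnell's bridge from Artin's functional equation and the entireness of the partial standard
L-functions of cuspidal representations of `GL₂`** (one-sided form of the analytic input). Assume,
over every number field `F`: (FE) `artin_functional_equation`; and (L¹) for every automorphic
measure `μ`, every cuspidal `Π ≤ L²_cusp(GL₂(𝔸_F) ⧸ A_G GL₂(F), μ)` and every Satake family `γ` of
`Π` off a finite `S`, `L^S(s, γ)` continues to an entire function from some right half-plane
(Jacquet–Langlands 1970, Thm. 11.1; Godement–Jacquet 1972, Thm. 13.8). Then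
`hasEntireContinuation_artinLFunction_of_isPiOfArtinRep` holds
(`hasEntireContinuation_artinLFunction_of_isPiOfArtinRep_of_FE_of_entire_partialL` with (L) from
(L¹), `exists_entire_partialL_and_dual_of_entire_partialL`).
[cite: Tunnell1981, p. 173] [cite: JacquetLanglands1970, §11, Thm. 11.1]
[cite: NeukirchANT1999, VII §12, Thm. (12.6)] -/
theorem hasEntireContinuation_artinLFunction_of_isPiOfArtinRep_of_FE_of_entire_partialL_oneSided
    (hFE : ∀ (F : Type) [Field F] [NumberField F], artin_functional_equation (K := F))
    (hL : ∀ (F : Type) [Field F] [NumberField F]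
      (μ : Measure (AdelicGroupData.gl 2 F).automorphicQuotient)
      [(AdelicGroupData.gl 2 F).IsAutomorphicMeasure μ] (P : CuspidalAutomorphicRepGL 2 F μ)
      (S : Finset (HeightOneSpectrum (𝓞 F))) (γ : SatakeFamily F), IsSatakeFamilyOf P ↑S γ →
        ∃ g : ℂ → ℂ, Differentiable ℂ g ∧ ∃ x₀ : ℝ, ∀ s : ℂ, x₀ < s.re →
          g s = partialStandardL ↑S γ s) :
    hasEntireContinuation_artinLFunction_of_isPiOfArtinRep :=
  hasEntireContinuation_artinLFunction_of_isPiOfArtinRep_of_FE_of_entire_partialL hFE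
    fun F _ _ μ _ P => exists_entire_partialL_and_dual_of_entire_partialL (hL F μ) P

end OneSided

end Literature.NumberTheory.Automorphic

end
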